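import Summits.SmoothPoincare4.SmoothPoincare4.Theorems.DottedCircleRasmussenDcrGapHelperHandlebodyChartModelHandlesRegime

/-!
# Helper `helper_handlebodyChart_modelHandles` (M3: handle structure of the model dotted handlebody `D_k`)
# of line `mk_friends` for crux `DcrGap` — handle charts, part 10: the arch in the frame of the chart
(item stmt-SmoothPoincare4-16128, route route-SmoothPoincare4-DottedCircleRasmussen)

Towards the cover clause `A_j ⊆ h_j(T)` of the registered stub `helper_handlebodyChart_modelHandles_data_part1`.
In the frame `u = v_j/|v_j|` of the hole direction a planar point `q = z - z₀` reads `f = q ū` (`q = f u`), and the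
arch conditions of the stub become the frame arch of `…ModelHandlesCover.lean`
(`ModelHandles.frame_of_arch`).  For a parameter `p` of the chart the frame point of `z(h p)` is
`f = (r' V/σ, r' m/σ)` (`ModelHandles.chart_frame`), so the planar inequalities of `…ModelHandlesGeometry.lean` show
that the boundary of the parameter box `K = {|p₀| ≤ 201/200, |p₁| ≤ 9/10, p₂² + p₃² ≤ 1}` is never mapped into the
arch (`ModelHandles.chart_arch_avoid`: a parameter mapped into the arch has `|p₀| ≤ 1`, `|p₁| ≠ 9/10`, `r ≥ 2/15`,
and `p₂² + p₃² ≤ 17/100` once `|w| ≤ 1/(2000(k+1))`), while the parameter `(0, 1/10, 0, 0)` is mapped to the apex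
region of the cap (`ModelHandles.chart_base_point`).

Registered summary `helper_handlebodyChart_modelHandles_frameArch`.  No definitions, no named facts, no `sorry`.
References: R. Kirby, *The Topology of 4-Manifolds*, LNM 1374 (1989), Ch. I §2 [Kirby1989].
-/

-- the prescribed namespace `Summit.<P>.<Sub>.…` duplicates `SmoothPoincare4` (P = Sub)
set_option linter.dupNamespace false
set_option linter.style.longLine false
noncomputable section

open scoped Manifold ContDiff Topology ComplexConjugate
open Function Set Metric Filter
open Literature.Topology.FourManifolds Literature.Topology.FourManifolds.MMSW
open Literature.AlgebraicTopology.Homotopy.HopfFibration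

namespace Summit.SmoothPoincare4.SmoothPoincare4.Theorems.DcrGap.MkFriends

namespace ModelHandles

/-! ## The arch in the frame of the hole direction -/

/-- **The stub's arch conditions in the frame of the hole direction**: with `u` unit, `v = V u` (`V > 0`) and
`f = q ū`, the cap/leg conditions on `q` are the frame-arch conditions on `f`, and `q = f u`. [folklore] -/
theorem frame_of_arch {V : ℝ} (hV : 0 < V) {u q : ℂ} (hu : ‖u‖ = 1)
    (hq : (8 / 5 ≤ ‖q - V * u‖ ∧ ‖q - V * u‖ ≤ 41 / 25 ∧ -(7 / 10) * ‖(V : ℂ) * u‖ ≤ ((q - V * u) * conj ((V : ℂ) * u)).re) ∨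
      (2 / 15 ≤ ‖q‖ ∧ ‖q‖ ≤ ‖(V : ℂ) * u‖ + 1 / 2 ∧ 0 < (q * conj ((V : ℂ) * u)).re ∧
        8 / 5 * ‖q‖ ≤ |(q * conj ((V : ℂ) * u)).im| ∧ |(q * conj ((V : ℂ) * u)).im| ≤ 41 / 25 * ‖q‖)) :
    q * conj u ∈ {p : ℂ | (8 / 5 ≤ ‖p - V‖ ∧ ‖p - V‖ ≤ 41 / 25 ∧ -(7 / 10) ≤ p.re - V) ∨
      (2 / 15 ≤ ‖p‖ ∧ ‖p‖ ≤ V + 1 / 2 ∧ 0 < p.re ∧ 8 / 5 * ‖p‖ ≤ |V * p.im| ∧ |V * p.im| ≤ 41 / 25 * ‖p‖)} ∧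
    q = q * conj u * u := by
  have huu : conj u * u = 1 := by
    rw [mul_comm, Complex.mul_conj, Complex.normSq_eq_norm_sq, hu]; norm_num
  have hVu : ‖(V : ℂ) * u‖ = V := by rw [norm_mul, Complex.norm_real, Real.norm_eq_abs, abs_of_pos hV, hu, mul_one]
  have hcu : ‖conj u‖ = 1 := by rw [Complex.norm_conj, hu]
  set f := q * conj u with hf
  have hq' : q = f * u := by rw [hf, mul_assoc, huu, mul_one]
  have e1 : q - V * u = (f - V) * u := by rw [hq']; ring
  have e2 : (q - V * u) * conj ((V : ℂ) * u) = (V : ℂ) * (f - V) := by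
    rw [e1, map_mul, Complex.conj_ofReal]; linear_combination (V : ℂ) * (f - V) * huu
  have e3 : q * conj ((V : ℂ) * u) = (V : ℂ) * f := by
    rw [hq', map_mul, Complex.conj_ofReal]; linear_combination (V : ℂ) * f * huu
  have n1 : ‖q - V * u‖ = ‖f - V‖ := by rw [e1, norm_mul, hu, mul_one]
  have n2 : ‖q‖ = ‖f‖ := by rw [hq', norm_mul, hu, mul_one]
  refine ⟨?_, hq'⟩
  rcases hq with ⟨h1, h2, h3⟩ | ⟨h1, h2, h3, h4, h5⟩
  · left
    refine ⟨by rw [← n1]; exact h1, by rw [← n1]; exact h2, ?_⟩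
    rw [e2, hVu, Complex.re_ofReal_mul, Complex.sub_re, Complex.ofReal_re] at h3
    nlinarith
  · right
    rw [e3, Complex.re_ofReal_mul, Complex.im_ofReal_mul, hVu, n2] at *
    exact ⟨h1, h2, pos_of_mul_pos_right h3 hV.le |> fun h => by nlinarith [h3], h4, h5⟩

/-! ## The frame point of a parameter -/

/-- **The frame point of `z(h p)`**: if `z(h p) = z₀ + f u` (`u = v/|v|`) then `f = (r' V/σ, r' m/σ)`:
`|f| = r'`, `|f - V|² = (r' V/σ - V)² + (r' m/σ)²`, `V Im f = V r' m/σ`. [folklore] -/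
theorem chart_frame {v zc z₀ z f : ℂ} {r' m σ ρ μ : ℝ} (hv0 : v ≠ 0) (hσ : σ ^ 2 = ‖v‖ ^ 2 + m ^ 2) (hσpos : 0 < σ)
    (hρ : ρ = r' / σ) (hμ : μ = r' * m / (‖v‖ * σ)) (hc : zc = z₀ + v) (hr' : 0 < r')
    (e1 : z - zc = v * (((ρ - 1 : ℝ) : ℂ) + (μ : ℂ) * Complex.I)) (hf : z = z₀ + f * (v / ((‖v‖ : ℝ) : ℂ))) :
    f.re = r' * ‖v‖ / σ ∧ f.im = r' * m / σ ∧ ‖f‖ = r' ∧ ‖f - ‖v‖‖ ^ 2 = (r' * ‖v‖ / σ - ‖v‖) ^ 2 + (r' * m / σ) ^ 2 := by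
  have hV : 0 < ‖v‖ := norm_pos_iff.2 hv0
  have hVc : ((‖v‖ : ℝ) : ℂ) ≠ 0 := by exact_mod_cast hV.ne'
  have hfv : f = ((‖v‖ : ℝ) : ℂ) * ((ρ : ℂ) + (μ : ℂ) * Complex.I) := by
    have h1 : f * (v / ((‖v‖ : ℝ) : ℂ)) = v * ((ρ : ℂ) + (μ : ℂ) * Complex.I) := by
      have := e1; rw [hf, hc] at this; push_cast at this; linear_combination this
    have h2 : f * v = f * (v / ((‖v‖ : ℝ) : ℂ)) * ((‖v‖ : ℝ) : ℂ) := by rw [mul_assoc, div_mul_cancel₀ _ hVc]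
    rw [h1] at h2
    have h3 : f * v = (((‖v‖ : ℝ) : ℂ) * ((ρ : ℂ) + (μ : ℂ) * Complex.I)) * v := by rw [h2]; ring
    exact mul_right_cancel₀ hv0 h3
  have hre0 : f.re = ‖v‖ * ρ := by rw [hfv]; simp
  have him0 : f.im = ‖v‖ * μ := by rw [hfv]; simp
  have hre : f.re = r' * ‖v‖ / σ := by rw [hre0, hρ]; ring
  have him : f.im = r' * m / σ := by rw [him0, hμ, mul_div_assoc', mul_div_mul_left _ _ hV.ne']
  have hff : f = Complex.mk (r' * ‖v‖ / σ) (r' * m / σ) := Complex.ext hre him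
  refine ⟨hre, him, ?_, ?_⟩
  · have h2 : ‖f‖ ^ 2 = r' ^ 2 := by
      rw [← Complex.normSq_eq_norm_sq, hff, Complex.normSq_mk]
      have : r' * ‖v‖ / σ * (r' * ‖v‖ / σ) + r' * m / σ * (r' * m / σ) = r' ^ 2 * (‖v‖ ^ 2 + m ^ 2) / σ ^ 2 := by ring
      rw [this, ← hσ]; field_simp
    exact (sq_eq_sq₀ (norm_nonneg _) hr'.le).1 h2
  · rw [← Complex.normSq_eq_norm_sq, hff, Complex.normSq_apply]
    simp; ring

/-! ## Parameters mapped into the arch -/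

/-- **A parameter mapped into the arch lies inside the parameter box**: if `z(h p) = z₀ + f u` with `f` in the frame
arch then `r ≥ 2/15`, `|p₀| ≤ 1` and `|p₁| ≠ 9/10` (the boundary curves `p₁ = ±9/10` miss the arch by the planar
inequalities); if moreover `|w(h p)| ≤ 1/(2000(k+1))` then `p₂² + p₃² ≤ 9/50`. [folklore] -/
theorem chart_arch_avoid {k : ℕ} {j : Fin k} {R S b : ℝ → ℝ} {fr fm : ℝ → ℝ → ℝ} {v : ℂ} {N : ℝ} {e : ℝ → ℂ}
    {h : EuclideanSpace ℝ (Fin 4) → EuclideanSpace ℝ (Fin 4)} {W : Set (EuclideanSpace ℝ (Fin 4))}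
    (hv : v = holeCentre k j - Complex.mk 0 (-(20 * (k : ℝ))))
    (hReven : ∀ t, R (-t) = R t) (hRout : ∀ t, 1 / 2 ≤ |t| → R t = 2 / 15 * (2 - |t|))
    (hRbend : ∀ t, |t| ≤ 1 / 5 → ‖v‖ - 1 / 250 ≤ R t ∧ R t ≤ ‖v‖)
    (hRbounds : ∀ t, -2 ≤ t → t ≤ 0 → 2 / 15 * (2 + t) ≤ R t ∧ R t ≤ ‖v‖) (hRmono : StrictMonoOn R (Icc (-2) 0))
    (hS0 : ∀ t, t ≤ -1 / 5 → S t = 0) (hS1 : ∀ t, 1 / 5 ≤ t → S t = 1) (hS01 : ∀ t, 0 ≤ S t ∧ S t ≤ 1)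
    (hb : b = fun p => (793 + 95 * p) / 500) (hN : N = 110 * ((k : ℝ) + 1))
    (he : ∀ m, e m = (((‖v‖ : ℝ) : ℂ) + (m : ℂ) * Complex.I) * (((Real.sqrt (‖v‖ ^ 2 + m ^ 2))⁻¹ : ℝ) : ℂ))
    (hfr : fr = fun t p => R t + b p * Real.sin (Real.pi * S t)) (hfm : fm = fun t p => -(b p) * Real.cos (Real.pi * S t))
    (hz : ∀ p, zC (h p) = Complex.mk 0 (-(20 * (k : ℝ))) +
      ((fr (p 0) (p 1) * Real.sqrt (1 - ((p 2) ^ 2 + (p 3) ^ 2) / N ^ 2) : ℝ) : ℂ) * (v / ((‖v‖ : ℝ) : ℂ)) * e (fm (p 0) (p 1)))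
    (hw : ∀ p, wC (h p) = ((fr (p 0) (p 1) / N : ℝ) : ℂ) * ((p 2 : ℂ) + (p 3 : ℂ) * Complex.I))
    (hWdef : W = {p : EuclideanSpace ℝ (Fin 4) | |p 0| < 101 / 100 ∧ |p 1| < 101 / 100 ∧ (p 2) ^ 2 + (p 3) ^ 2 < 6 / 5})
    {p : EuclideanSpace ℝ (Fin 4)} (hp : p ∈ W) {f : ℂ}
    (hf : zC (h p) = Complex.mk 0 (-(20 * (k : ℝ))) + f * (v / ((‖v‖ : ℝ) : ℂ)))
    (hA : (8 / 5 ≤ ‖f - ‖v‖‖ ∧ ‖f - ‖v‖‖ ≤ 41 / 25 ∧ -(7 / 10) ≤ f.re - ‖v‖) ∨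
      (2 / 15 ≤ ‖f‖ ∧ ‖f‖ ≤ ‖v‖ + 1 / 2 ∧ 0 < f.re ∧ 8 / 5 * ‖f‖ ≤ |‖v‖ * f.im| ∧ |‖v‖ * f.im| ≤ 41 / 25 * ‖f‖)) :
    2 / 15 ≤ fr (p 0) (p 1) ∧ |p 0| ≤ 1 ∧ p 1 ≠ 9 / 10 ∧ p 1 ≠ -(9 / 10) ∧
      (‖wC (h p)‖ ≤ 1 / (2000 * ((k : ℝ) + 1)) → (p 2) ^ 2 + (p 3) ^ 2 ≤ 9 / 50) := by
  obtain ⟨-, -, hk, -, -, h20, -, hv0, hVpos⟩ := holeDir_props j hv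
  obtain ⟨-, -, hrpos, -, -, -, -, -, -, hout, -, -⟩ := chart_regime hv hReven hRout hRbend hRbounds hRmono hS0 hS1 hS01 hb hN hfr hfm hWdef hp
  obtain ⟨r', m, σ, ρ, μ, hm, -, hσ2, hσpos, hVσ, hσV, -, hr'pos, -, hr'le, hρ, -, -, hμ, -, -, e1, -, -, -, -, -, hgeo⟩ :=
    chart_point hv hReven hRout hRbend hRbounds hRmono hS0 hS1 hS01 hb hN he hfr hfm hz hWdef hp
  have hc : holeCentre k j = Complex.mk 0 (-(20 * (k : ℝ))) + v := by rw [hv]; ring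
  obtain ⟨hre, him, hnf, hnfV⟩ := chart_frame hv0 hσ2 hσpos hρ hμ hc hr'pos e1 hf
  -- `r' ≥ 2/15`
  have hr2 : 2 / 15 ≤ r' := by
    rcases hA with ⟨-, h2, -⟩ | ⟨h1, -⟩
    · have := norm_sub_norm_le (((‖v‖ : ℝ) : ℂ)) (((‖v‖ : ℝ) : ℂ) - f)
      rw [sub_sub_cancel, Complex.norm_real, Real.norm_eq_abs, abs_of_pos hVpos, norm_sub_rev] at this
      linarith
    · rwa [hnf] at h1
  have hfr2 : 2 / 15 ≤ fr (p 0) (p 1) := hr2.trans hr'le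
  have hp0 : |p 0| ≤ 1 := by
    by_contra h0
    push Not at h0
    have := hout (by linarith)
    linarith
  -- the lateral ratio in the legs: `8/5 ≤ V |m| / σ ≤ 41/25`, squared
  have hlegs : 8 / 5 * ‖f‖ ≤ |‖v‖ * f.im| → |‖v‖ * f.im| ≤ 41 / 25 * ‖f‖ →
      (8 / 5 : ℝ) ^ 2 * σ ^ 2 ≤ ‖v‖ ^ 2 * m ^ 2 ∧ ‖v‖ ^ 2 * m ^ 2 ≤ (41 / 25 : ℝ) ^ 2 * σ ^ 2 := by
    intro h4 h5
    rw [hnf, him, show ‖v‖ * (r' * m / σ) = r' * (‖v‖ * m / σ) by ring, abs_mul, abs_of_pos hr'pos] at h4 h5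
    have h4' : 8 / 5 ≤ |‖v‖ * m / σ| := by
      rw [mul_comm] at h4; exact le_of_mul_le_mul_left h4 hr'pos
    have h5' : |‖v‖ * m / σ| ≤ 41 / 25 := by
      rw [mul_comm (41 / 25 : ℝ)] at h5; exact le_of_mul_le_mul_left h5 hr'pos
    rw [abs_div, abs_of_pos hσpos, abs_mul, abs_of_pos hVpos, le_div_iff₀ hσpos] at h4'
    rw [abs_div, abs_of_pos hσpos, abs_mul, abs_of_pos hVpos, div_le_iff₀ hσpos] at h5'
    constructor
    · have := pow_le_pow_left₀ (by positivity) h4' 2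
      rw [mul_pow, mul_pow, sq_abs] at this; linarith
    · have := pow_le_pow_left₀ (by positivity) h5' 2
      rw [mul_pow, mul_pow, sq_abs] at this; linarith
  refine ⟨hfr2, hp0, fun h91 => ?_, fun h91 => ?_, fun hwle => ?_⟩
  · -- the outer boundary curve `p₁ = 9/10`: `b = 1.757`
    have hb91 : b (p 1) = 1757 / 1000 := by rw [hb, h91]; norm_num
    rw [hb91] at hgeo
    rcases hA with ⟨-, h2, -⟩ | ⟨-, h2, -, h4, h5⟩
    · have hreg : m ^ 2 = (1757 / 1000) ^ 2 ∨ ∃ s c : ℝ, m ^ 2 = (1757 / 1000) ^ 2 * c ^ 2 ∧ s ^ 2 + c ^ 2 = 1 ∧ 0 ≤ s ∧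
          ‖v‖ + 1757 / 1000 * s - 1 / 100 ≤ r' := by
        rcases hgeo with ⟨hm2, -⟩ | ⟨-, s, c, hm2, hsc, hs, hlo, -⟩
        · exact Or.inl hm2
        · exact Or.inr ⟨s, c, hm2, hsc, hs, hlo⟩
      have := outer_not_cap h20 hσ2 hσpos hVσ hreg
      rw [← hnfV] at this
      have h2' := pow_le_pow_left₀ (norm_nonneg _) h2 2
      linarith
    · obtain ⟨-, hhi⟩ := hlegs h4 h5
      rcases hgeo with ⟨hm2, -⟩ | ⟨-, s, c, hm2, hsc, hs, hlo, -⟩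
      · have := lateral_leg_gt h20 hσ2 le_rfl hm2; linarith
      · have := outer_bend_radius h20 hσ2 hm2 hsc hs hlo hhi
        rw [hnf] at h2; linarith
  · -- the inner boundary curve `p₁ = -9/10`: `b = 1.415`
    have hb91 : b (p 1) = 1415 / 1000 := by rw [hb, h91]; norm_num
    rw [hb91] at hgeo
    rcases hA with ⟨h1, -, h3⟩ | ⟨-, -, -, h4, h5⟩
    · have hreg : (m ^ 2 = (1415 / 1000) ^ 2 ∧ r' ≤ ‖v‖) ∨ ∃ s c : ℝ, m ^ 2 = (1415 / 1000) ^ 2 * c ^ 2 ∧ s ^ 2 + c ^ 2 = 1 ∧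
          0 ≤ s ∧ ‖v‖ + 1415 / 1000 * s - 1 / 100 ≤ r' ∧ r' ≤ ‖v‖ + 1415 / 1000 * s := by
        rcases hgeo with ⟨hm2, hrV, -⟩ | ⟨-, s, c, hm2, hsc, hs, hlo, hhi, -⟩
        · exact Or.inl ⟨hm2, hrV⟩
        · exact Or.inr ⟨s, c, hm2, hsc, hs, hlo, hhi⟩
      rw [hre] at h3
      have := inner_not_cap h20 hσ2 hσpos hVσ hσV hr'pos.le hreg h3
      rw [← hnfV] at this
      have h1' := pow_le_pow_left₀ (by norm_num) h1 2
      linarith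
    · obtain ⟨hlo, -⟩ := hlegs h4 h5
      have hm2 : m ^ 2 ≤ (1415 / 1000) ^ 2 := by
        rcases hgeo with ⟨hm2, -⟩ | ⟨-, s, c, hm2, hsc, -⟩
        · exact hm2.le
        · have hc2 : c ^ 2 ≤ 1 := by linarith [sq_nonneg s]
          rw [hm2]; exact mul_le_of_le_one_right (by norm_num) hc2
      have := lateral_lt hVpos hσ2 (by norm_num : (1415 / 1000 : ℝ) < 8 / 5) (by norm_num) hm2
      linarith
  · -- the `w`-coordinate
    have hNpos : 0 < N := by rw [hN]; positivity
    rw [hw, norm_mul, Complex.norm_real, Real.norm_eq_abs, abs_of_pos (div_pos hrpos hNpos), Complex.norm_add_mul_I] at hwle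
    have h1 : fr (p 0) (p 1) / N * Real.sqrt ((p 2) ^ 2 + (p 3) ^ 2) ≤ 11 / 200 / N := by
      apply hwle.trans
      rw [hN, div_le_div_iff₀ (by positivity) (by positivity)]
      linarith
    rw [div_mul_eq_mul_div, div_le_div_iff_of_pos_right hNpos] at h1
    have h2 : Real.sqrt ((p 2) ^ 2 + (p 3) ^ 2) ≤ 33 / 80 := by
      have := mul_le_mul_of_nonneg_right hfr2 (Real.sqrt_nonneg ((p 2) ^ 2 + (p 3) ^ 2))
      linarith
    have h3 := Real.sqrt_le_sqrt (show ((p 2) ^ 2 + (p 3) ^ 2) ≤ (p 2) ^ 2 + (p 3) ^ 2 from le_rfl)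
    have h4 : (p 2) ^ 2 + (p 3) ^ 2 ≤ (33 / 80) ^ 2 := by
      rw [← Real.sqrt_le_sqrt_iff (by positivity), Real.sqrt_sq (by norm_num)]
      exact h2
    linarith

/-! ## The base point -/

/-- **The parameter `(0, 3/20, 0, 0)` is mapped to the apex region of the cap**: it lies in `W` and in the open box,
`w = 0`, and `z - z₀ = f u` with `f` real, `f - V ∈ [1.6, 1.62]`. [folklore] -/
theorem chart_base_point {k : ℕ} {j : Fin k} {R S b : ℝ → ℝ} {fr fm : ℝ → ℝ → ℝ} {v : ℂ} {N : ℝ} {e : ℝ → ℂ}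
    {h : EuclideanSpace ℝ (Fin 4) → EuclideanSpace ℝ (Fin 4)} {W : Set (EuclideanSpace ℝ (Fin 4))}
    (hv : v = holeCentre k j - Complex.mk 0 (-(20 * (k : ℝ))))
    (hReven : ∀ t, R (-t) = R t) (hSsymm : ∀ t, S (-t) = 1 - S t) (hRout : ∀ t, 1 / 2 ≤ |t| → R t = 2 / 15 * (2 - |t|))
    (hRbend : ∀ t, |t| ≤ 1 / 5 → ‖v‖ - 1 / 250 ≤ R t ∧ R t ≤ ‖v‖)
    (hRbounds : ∀ t, -2 ≤ t → t ≤ 0 → 2 / 15 * (2 + t) ≤ R t ∧ R t ≤ ‖v‖) (hRmono : StrictMonoOn R (Icc (-2) 0))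
    (hS0 : ∀ t, t ≤ -1 / 5 → S t = 0) (hS1 : ∀ t, 1 / 5 ≤ t → S t = 1) (hS01 : ∀ t, 0 ≤ S t ∧ S t ≤ 1)
    (hb : b = fun p => (793 + 95 * p) / 500) (hN : N = 110 * ((k : ℝ) + 1))
    (he : ∀ m, e m = (((‖v‖ : ℝ) : ℂ) + (m : ℂ) * Complex.I) * (((Real.sqrt (‖v‖ ^ 2 + m ^ 2))⁻¹ : ℝ) : ℂ))
    (hfr : fr = fun t p => R t + b p * Real.sin (Real.pi * S t)) (hfm : fm = fun t p => -(b p) * Real.cos (Real.pi * S t))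
    (hz : ∀ p, zC (h p) = Complex.mk 0 (-(20 * (k : ℝ))) +
      ((fr (p 0) (p 1) * Real.sqrt (1 - ((p 2) ^ 2 + (p 3) ^ 2) / N ^ 2) : ℝ) : ℂ) * (v / ((‖v‖ : ℝ) : ℂ)) * e (fm (p 0) (p 1)))
    (hw : ∀ p, wC (h p) = ((fr (p 0) (p 1) / N : ℝ) : ℂ) * ((p 2 : ℂ) + (p 3 : ℂ) * Complex.I))
    (hWdef : W = {p : EuclideanSpace ℝ (Fin 4) | |p 0| < 101 / 100 ∧ |p 1| < 101 / 100 ∧ (p 2) ^ 2 + (p 3) ^ 2 < 6 / 5}) :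
    (!₂[0, 3 / 20, 0, 0] : EuclideanSpace ℝ (Fin 4)) ∈ W ∧ wC (h !₂[0, 3 / 20, 0, 0]) = 0 ∧
    ∃ f : ℂ, zC (h !₂[0, 3 / 20, 0, 0]) = Complex.mk 0 (-(20 * (k : ℝ))) + f * (v / ((‖v‖ : ℝ) : ℂ)) ∧
      8 / 5 ≤ ‖f - ‖v‖‖ ∧ ‖f - ‖v‖‖ ≤ 41 / 25 ∧ -(7 / 10) ≤ f.re - ‖v‖ := by
  obtain ⟨-, -, hk, -, -, h20, -, hv0, hVpos⟩ := holeDir_props j hv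
  have hpW : (!₂[0, 3 / 20, 0, 0] : EuclideanSpace ℝ (Fin 4)) ∈ W := by
    rw [hWdef]; simp; norm_num
  obtain ⟨r', m, σ, ρ, μ, hm, hσ, hσ2, hσpos, hVσ, hσV, -, hr'pos, -, -, hρ, -, -, hμ, -, -, e1, -, -, -, -, -, hgeo⟩ :=
    chart_point hv hReven hRout hRbend hRbounds hRmono hS0 hS1 hS01 hb hN he hfr hfm hz hWdef hpW
  have hc : holeCentre k j = Complex.mk 0 (-(20 * (k : ℝ))) + v := by rw [hv]; ring
  -- at the apex `m = 0`
  have hS0' : S 0 = 1 / 2 := by have := hSsymm 0; rw [neg_zero] at this; linarith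
  have hi0 : (!₂[0, 3 / 20, 0, 0] : EuclideanSpace ℝ (Fin 4)) 0 = 0 := by simp
  have hi1 : (!₂[0, 3 / 20, 0, 0] : EuclideanSpace ℝ (Fin 4)) 1 = 3 / 20 := by simp
  have hm0 : m = 0 := by
    rw [hm, hfm, hi0, hi1]
    show -(b (3 / 20)) * Real.cos (Real.pi * S 0) = 0
    rw [hS0', show Real.pi * (1 / 2) = Real.pi / 2 by ring, Real.cos_pi_div_two, mul_zero]
  have hσV : σ = ‖v‖ := by rw [hσ, hm0]; simp [Real.sqrt_sq hVpos.le]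
  have hb' : b (3 / 20) = 16145 / 10000 := by rw [hb]; norm_num
  -- the radius at the apex
  have hr' : ‖v‖ + 8 / 5 ≤ r' ∧ r' ≤ ‖v‖ + 81 / 50 := by
    rcases hgeo with ⟨-, -, h5, -⟩ | ⟨-, s, c, hm2, hsc, hs, hlo, hhi, -⟩
    · exfalso; rw [hi0, abs_zero] at h5; norm_num at h5
    · rw [hi1, hb'] at hlo hhi hm2
      have hc0 : c = 0 := by
        rw [hm0] at hm2
        have : (16145 / 10000 : ℝ) ^ 2 * c ^ 2 = 0 := by rw [← hm2]; ring
        rcases mul_eq_zero.1 this with h0 | h0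
        · norm_num at h0
        · exact pow_eq_zero_iff two_ne_zero |>.1 h0
      have hs1 : s = 1 := by
        have : s ^ 2 = 1 := by rw [hc0] at hsc; linarith
        exact (pow_eq_one_iff_of_nonneg hs two_ne_zero).1 this
      rw [hs1] at hlo hhi
      constructor <;> linarith
  -- the frame point is real
  set f : ℂ := ((r' : ℝ) : ℂ) with hf
  have hzf : zC (h !₂[0, 3 / 20, 0, 0]) = Complex.mk 0 (-(20 * (k : ℝ))) + f * (v / ((‖v‖ : ℝ) : ℂ)) := by
    have hVc : ((‖v‖ : ℝ) : ℂ) ≠ 0 := by exact_mod_cast hVpos.ne'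
    have hμ0 : μ = 0 := by rw [hμ, hm0]; simp
    have hρ' : ρ = r' / ‖v‖ := by rw [hρ, hσV]
    have := e1
    rw [hc, hμ0, hρ'] at this
    rw [hf]
    field_simp
    push_cast at this ⊢
    field_simp at this
    linear_combination this
  refine ⟨hpW, by rw [hw]; simp, f, hzf, ?_, ?_, ?_⟩
  · rw [hf, ← Complex.ofReal_sub, Complex.norm_real, Real.norm_eq_abs, abs_of_pos (by linarith)]; linarith
  · rw [hf, ← Complex.ofReal_sub, Complex.norm_real, Real.norm_eq_abs, abs_of_pos (by linarith)]; linarith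
  · rw [hf, Complex.ofReal_re]; linarith

end ModelHandles

/-- **Registered piece `helper_handlebodyChart_modelHandles_frameArch` of the data stub, part 1 (the arch in the frame
of the chart)**: the stub's cap/leg conditions on `q = z - z₀` relative to `v = V u` (`u` unit, `V > 0`) are the
frame-arch conditions on `f = q ū`, with `q = f u` (`ModelHandles.frame_of_arch`). [folklore] -/
theorem helper_handlebodyChart_modelHandles_frameArch : ∀ (V : ℝ), 0 < V → ∀ (u q : ℂ), ‖u‖ = 1 → ((8 / 5 ≤ ‖q - V * u‖ ∧ ‖q - V * u‖ ≤ 41 / 25 ∧ -(7 / 10) * ‖(V : ℂ) * u‖ ≤ ((q - V * u) * (starRingEnd ℂ) ((V : ℂ) * u)).re) ∨ (2 / 15 ≤ ‖q‖ ∧ ‖q‖ ≤ ‖(V : ℂ) * u‖ + 1 / 2 ∧ 0 < (q * (starRingEnd ℂ) ((V : ℂ) * u)).re ∧ 8 / 5 * ‖q‖ ≤ |(q * (starRingEnd ℂ) ((V : ℂ) * u)).im| ∧ |(q * (starRingEnd ℂ) ((V : ℂ) * u)).im| ≤ 41 / 25 * ‖q‖)) → q * (starRingEnd ℂ) u ∈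 {p : ℂ | (8 / 5 ≤ ‖p - V‖ ∧ ‖p - V‖ ≤ 41 / 25 ∧ -(7 / 10) ≤ p.re - V) ∨ (2 / 15 ≤ ‖p‖ ∧ ‖p‖ ≤ V + 1 / 2 ∧ 0 < p.re ∧ 8 / 5 * ‖p‖ ≤ |V * p.im| ∧ |V * p.im| ≤ 41 / 25 * ‖p‖)} ∧ q = q * (starRingEnd ℂ) u * u :=
  fun _ hV _ _ hu hq => ModelHandles.frame_of_arch hV hu hq

end Summit.SmoothPoincare4.SmoothPoincare4.Theorems.DcrGap.MkFriends

end
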